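import Summits.NavierStokesRegularity.NavierStokesRegularity.Theses.SqueezeCycle
import Literature.Analysis.FluidPDE.ParasiticSlabFlow

/-!
# `RecurrentLiouville` (crux stmt-NavierStokesRegularity-1589): the Albritton–Barker bound
# `𝐈 < ⊤` is load-bearing — negative-side support (cdisprove, gen 2)

Importable lemma of the standing disprover of the crux `SqueezeCycle.RecurrentLiouville`
(= `RecurrentProfiles.RecurrentLiouville`, item stmt-NavierStokesRegularity-1589, shared), over
the landed explicit witness `Literature/Analysis/FluidPDE/ParasiticSlabFlow.lean`
(KNSS's parasitic slab flow `u = (C/√(−t)) e₀`, `p = −ȧ(t) ⟪e₀, x⟫`: a suitable weak solution of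
Navier–Stokes on the open backward slab with weak gradient `0`, the Type-I rate, a
backward-singular origin, and `𝐈 = ⊤` for every pressure / gradient candidate):

* `parasitic_recurrent` — the parasitic flow is a fixed point of the scaling flow, hence satisfies
  the recurrence clause of the crux verbatim (every log-scale is an exact return time);
* `RecurrentLiouvilleWithoutTypeIBound` — the crux with `typeIBound … < ⊤` DROPPED (equations,
  weak gradient, rate, recurrence, conclusion verbatim, same order);
* `recurrentLiouville_false_without_typeIBound` — it is FALSE (parasitic flow, `C = 1`): any
  proof of the crux must use `𝐈 < ⊤`; the time-only rate `‖u(t,x)‖ ≤ C/√(−t)` together with the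
  equations, suitability and recurrence does not see the origin singularity of a spatially
  constant drift;
* `parasitic_witness_typeIBound_eq_top` — the witness violates exactly the dropped clause, so it
  does not touch the crux itself.

Companion of `FalseWithoutNavierStokes.lean` (equations load-bearing, kinematic bump).

## References

* G. Koch, N. Nadirashvili, G. Seregin, V. Šverák, Acta Math. 203 (2009), §1, (1.4). [KNSS2009]
* D. Albritton, T. Barker, J. Math. Fluid Mech. 21 (2019), §1 ("`v ≡ const` and `𝐈 < ∞` imply
  `v ≡ 0`"). [AlbrittonBarker2019]
-/

noncomputable section

open MeasureTheory TopologicalSpace Set Function Filter Topology Metric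
open scoped InnerProductSpace RealInnerProductSpace ENNReal NNReal
open Literature.Analysis.FluidPDE
open Summit.NavierStokesRegularity.NavierStokesRegularity.Theses

set_option linter.dupNamespace false

namespace Summit.NavierStokesRegularity.NavierStokesRegularity.Theorems.RecurrentLiouville.Negative

/-- Physical space. -/
local notation "ℝ³" => EuclideanSpace ℝ (Fin 3)

/-- The open backward slab `(-∞,0) × ℝ³` (time first), as in the route file. -/
local notation "𝕊" => Literature.Analysis.FluidPDE.slab (EuclideanSpace ℝ (Fin 3)) (Set.Iio (0 : ℝ)) isOpen_Iio

/-- The parasitic flow satisfies the recurrence clause of the crux verbatim: it is exactly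
backward self-similar (`parasitic_nsRescale`), so every log-scale is an exact return time.
[folklore] -/
theorem parasitic_recurrent (C : ℝ) :
    ∀ ε : ℝ, 0 < ε → ∀ K : Set (ℝ × ℝ³), IsCompact K → K ⊆ Set.Iic (0 : ℝ) ×ˢ Set.univ →
      ∃ L : ℝ, 0 < L ∧ ∀ a : ℝ, ∃ σ ∈ Set.Icc a (a + L),
        MeasureTheory.eLpNorm (fun z : ℝ × ℝ³ =>
          nsRescale (Real.exp σ) (parasiticVelocity C) z.1 z.2 - parasiticVelocity C z.1 z.2) 3
          (MeasureTheory.volume.restrict K) ≤ ENNReal.ofReal ε := by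
  intro ε _ K _ _
  refine ⟨1, one_pos, fun a => ⟨a, ⟨le_rfl, by linarith⟩, ?_⟩⟩
  have h1 : (fun z : ℝ × ℝ³ => nsRescale (Real.exp a) (parasiticVelocity C) z.1 z.2 -
      parasiticVelocity C z.1 z.2) = 0 := by
    funext z
    rw [parasitic_nsRescale C (Real.exp_pos a)]
    simp
  rw [h1, eLpNorm_zero]
  exact bot_le

/-- The crux `RecurrentLiouville` with `typeIBound (Iio 0 ×ˢ univ) u p G < ⊤` DROPPED (all other
clauses verbatim, in the same order). -/
def RecurrentLiouvilleWithoutTypeIBound : Prop :=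
  ∀ (u : ℝ → ℝ³ → ℝ³) (p : ℝ → ℝ³ → ℝ) (G : ℝ → ℝ³ → ℝ³ →L[ℝ] ℝ³) (C : ℝ),
    IsSuitableWeakSolutionOn 𝕊 1 0 u p →
    HasWeakSpatialGradientOn 𝕊 u G →
    HasTypeITimeDecay C u →
    (∀ ε : ℝ, 0 < ε → ∀ K : Set (ℝ × ℝ³), IsCompact K → K ⊆ Set.Iic (0 : ℝ) ×ˢ Set.univ →
      ∃ L : ℝ, 0 < L ∧ ∀ a : ℝ, ∃ σ ∈ Set.Icc a (a + L),
        MeasureTheory.eLpNorm (fun z : ℝ × ℝ³ => nsRescale (Real.exp σ) u z.1 z.2 - u z.1 z.2) 3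
          (MeasureTheory.volume.restrict K) ≤ ENNReal.ofReal ε) →
    ¬ IsBackwardSingularPoint u 0

/-- Sanity: guarding `RecurrentLiouvilleWithoutTypeIBound`'s conclusion by `𝐈 < ⊤` gives back the
crux (the two differ by exactly that clause). -/
theorem recurrentLiouville_of_iff_withoutTypeIBound_guarded :
    SqueezeCycle.RecurrentLiouville ↔
      ∀ (u : ℝ → ℝ³ → ℝ³) (p : ℝ → ℝ³ → ℝ) (G : ℝ → ℝ³ → ℝ³ →L[ℝ] ℝ³) (C : ℝ),
        IsSuitableWeakSolutionOn 𝕊 1 0 u p → HasWeakSpatialGradientOn 𝕊 u G →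
        HasTypeITimeDecay C u →
        (∀ ε : ℝ, 0 < ε → ∀ K : Set (ℝ × ℝ³), IsCompact K → K ⊆ Set.Iic (0 : ℝ) ×ˢ Set.univ →
          ∃ L : ℝ, 0 < L ∧ ∀ a : ℝ, ∃ σ ∈ Set.Icc a (a + L),
            MeasureTheory.eLpNorm (fun z : ℝ × ℝ³ => nsRescale (Real.exp σ) u z.1 z.2 - u z.1 z.2) 3
              (MeasureTheory.volume.restrict K) ≤ ENNReal.ofReal ε) →
        typeIBound (Set.Iio (0 : ℝ) ×ˢ Set.univ) u p G < ⊤ → ¬ IsBackwardSingularPoint u 0 :=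
  ⟨fun h u p G C hsw hwg hdec hrec hI => h u p G C hsw hwg hI hdec hrec,
    fun h u p G C hsw hwg hI hdec hrec => h u p G C hsw hwg hdec hrec hI⟩

/-- **`𝐈 < ⊤` is load-bearing in `RecurrentLiouville`.** With the Albritton–Barker bound dropped
the crux is FALSE: the parasitic slab flow with `C = 1` is a suitable weak solution on the slab
with weak gradient `0`, has the Type-I rate, is uniformly recurrent (a fixed point of the scaling
flow) and is singular at the origin. [cite: KNSS2009, §1 (1.4)] -/
theorem recurrentLiouville_false_without_typeIBound : ¬ RecurrentLiouvilleWithoutTypeIBound :=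
  fun h => h _ _ _ 1 (parasitic_isSuitableWeakSolutionOn 1) (parasitic_hasWeakSpatialGradientOn 1)
    (parasitic_hasTypeITimeDecay zero_le_one) (parasitic_recurrent 1)
    (parasitic_isBackwardSingularPoint_zero one_pos)

/-- Packaged: the antecedent of the crux MINUS `𝐈 < ⊤` is inhabited by an origin-singular,
uniformly recurrent suitable weak solution with the rate (dynamical non-vacuity of the singular
side in the time-rate class). [cite: KNSS2009, §1 (1.4)] -/
theorem classWithoutTypeIBound_singular_inhabited :
    ∃ (u : ℝ → ℝ³ → ℝ³) (p : ℝ → ℝ³ → ℝ) (G : ℝ → ℝ³ → ℝ³ →L[ℝ] ℝ³) (C : ℝ),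
      IsSuitableWeakSolutionOn 𝕊 1 0 u p ∧ HasWeakSpatialGradientOn 𝕊 u G ∧
      HasTypeITimeDecay C u ∧
      (∀ ε : ℝ, 0 < ε → ∀ K : Set (ℝ × ℝ³), IsCompact K → K ⊆ Set.Iic (0 : ℝ) ×ˢ Set.univ →
        ∃ L : ℝ, 0 < L ∧ ∀ a : ℝ, ∃ σ ∈ Set.Icc a (a + L),
          MeasureTheory.eLpNorm (fun z : ℝ × ℝ³ => nsRescale (Real.exp σ) u z.1 z.2 - u z.1 z.2) 3
            (MeasureTheory.volume.restrict K) ≤ ENNReal.ofReal ε) ∧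
      IsBackwardSingularPoint u 0 :=
  ⟨_, _, _, 1, parasitic_isSuitableWeakSolutionOn 1, parasitic_hasWeakSpatialGradientOn 1,
    parasitic_hasTypeITimeDecay zero_le_one, parasitic_recurrent 1,
    parasitic_isBackwardSingularPoint_zero one_pos⟩

/-- ... and the witness violates exactly the dropped clause (`𝐈 = ⊤` for EVERY pressure and
gradient candidate), so it does not touch the crux. [cite: AlbrittonBarker2019, §1] -/
theorem parasitic_witness_typeIBound_eq_top (p : ℝ → ℝ³ → ℝ) (G : ℝ → ℝ³ → ℝ³ →L[ℝ] ℝ³) :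
    typeIBound (Set.Iio (0 : ℝ) ×ˢ Set.univ) (parasiticVelocity 1) p G = ⊤ :=
  parasitic_typeIBound_eq_top one_pos p G

end Summit.NavierStokesRegularity.NavierStokesRegularity.Theorems.RecurrentLiouville.Negative

end
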